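import Literature.AlgebraicGeometry.HodgeTheory.AlgebraicClassesCup
import Literature.AlgebraicGeometry.HodgeTheory.AlgebraicClassesHodgeTypeHolds
import Literature.AlgebraicGeometry.HodgeTheory.HodgeTypeExteriorProduct
import Literature.AlgebraicGeometry.HodgeTheory.LefschetzOneOneHolds
import Literature.AlgebraicGeometry.HodgeTheory.SupportedClassesRationalProofs
import Literature.AlgebraicGeometry.HodgeTheory.GysinFormalismCorrespondences
import Literature.NumberTheory.Transcendental.DeRhamTheoremMultiplicative
import Literature.AlgebraicGeometry.HodgeTheory.HardLefschetzNFoldHolds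
import Literature.AlgebraicGeometry.HodgeTheory.MotivatedClassesLefschetzRange
import HarnessLib

/-!
# `Nˡ H²ˡ ∪ Nᵏ H²ᵏ ⊆ Nˡ⁺ᵏ` in degree `2(dim X − 1)`: the submaximal degree of Voisin II Prop. 9.20 on the coniveau carrier, unconditionally (hard Lefschetz)

Family `hodge`, layer `Literature/AlgebraicGeometry/HodgeTheory`. Companion of
`AlgebraicClassesCupOffRange` (`l + k ≥ dim X`: the top class or nothing) and
`AlgebraicClassesCupDivisorHolds` (`min(l, k) ≤ 1`; neither is imported here) toward the named fact
`Voisin2003_cupProduct_algebraicClasses` (`MotivatedClassesAssembly`; C. Voisin, *Hodge Theory and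
Complex Algebraic Geometry II*, Prop. 9.20, "`cl(Z · Z') = cl(Z) ∪ cl(Z')`", on the carrier
`algebraicClasses X p = Nᵖ H²ᵖ(X(ℂ); ℂ)`). One more slice needs no moving lemma: the degree
`2(l + k) = 2(n − 1)`, `n = dim X`. Indeed on a smooth projective complex `n`-fold EVERY rational
`(n−1, n−1)`-class is algebraic — the classical remark that the Hodge conjecture holds for curve
classes (hard Lefschetz `Lⁿ⁻² : H²(X, ℚ) ⥲ H²ⁿ⁻²(X, ℚ)`, C. Voisin, *Hodge Theory I*, Thm. 6.25 with
Rem. 6.27 and §7.1.2; a rational `(n−1, n−1)`-class is `Lⁿ⁻² c'` with `c'` rational of type `(1,1)`, a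
divisor class by Lefschetz `(1,1)`, Thm. 11.30, and `[H]ⁿ⁻² ∪ [D] = [Hⁿ⁻² · D]`; Kerr–Pearlstein 2011
§3.1), which the tree has as `mem_algebraicClasses_of_lefschetzRange` (`MotivatedClassesLefschetzRange`)
over the two named facts `lefschetzOneOne_rational`, `nonempty_hardLefschetzNFold n X` — both THEOREMS
now (`lefschetzOneOne_rational_holds`, `nonempty_hardLefschetzNFold_holds`). A product `a ∪ b` of rational
classes dying off closed subsets is rational (`IsRationalClass.cup`) and of type `(l + k, l + k)`
(`cupPreservesHodgeType_of_multiplicative_deRham`, algebraic classes being Hodge classes); rational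
classes span the coniveau spaces (`span_isRationalClass_eq_top_of_isSmoothProjective_holds`).
PRIOR ART, summit-side: this mechanism and range were first landed as a crux stub of route
`HeckePrymWeil` (`Summit.….Theorems.cupProduct_algebraicClasses_of_dim_le_add_add_one`,
`…_of_closedRange`, file `Summits/HodgeConjecture/HodgeConjecture/Theorems/HeckePrymWeilSummitOffWeilSectorCupProductInstances.lean`),
which Literature files cannot import; this file is the Literature home of the same slice (so that
Literature consumers of `Voisin2003_cupProduct_algebraicClasses` can use it), with the bilinear
reduction isolated for reuse.

* `cupProduct_mem_of_forall_isRationalClass` — the bilinear reduction used by both companion files,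
  isolated: a submodule containing `a ∪ b` for all RATIONAL `a` dying off a closed `Z` of
  codimension `≥ l` and RATIONAL `b` dying off a closed `W` of codimension `≥ k` contains
  `Nˡ H²ˡ ∪ Nᵏ H²ᵏ`;
* `mem_algebraicClasses_of_lefschetzRange_holds` — rational `(p, p)`-classes with `p ≤ 1` or
  `dim X ≤ p + 1` are algebraic, unconditionally (the tree's `mem_algebraicClasses_of_lefschetzRange`
  fed with the two discharges);
* `cupProduct_mem_algebraicClasses_of_dim_le_add_add_one` — **`Nˡ H²ˡ ∪ Nᵏ H²ᵏ ⊆ Nˡ⁺ᵏ H²ˡ⁺²ᵏ` on every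
  smooth projective complex `X` with `dim X ≤ l + k + 1`**;
Together with `cupProduct_mem_algebraicClasses_of_min_le_one` (`AlgebraicClassesCupDivisorHolds`, not
imported here) the unconditional range is `min(l, k) ≤ 1 ∨ dim X ≤ l + k + 1`; what is left of the named
fact is `2 ≤ l`, `2 ≤ k`, `l + k + 2 ≤ dim X` — first instance `(l, k) = (2, 2)` on a sixfold (e.g. the
leaf `cupProduct_mem_algebraicClasses_tripleProduct_surfaces` of `Surfaces/K3SurfaceBuskinLeaves`) — and
there it follows from `Motives.Roberts1972_genericProjection` (summit-side
`Theorems.voisin2003_of_roberts1972`).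

Theorems only; no definition, no named fact (D-0026).

## References

* [VoisinHodgeII2003] C. Voisin, Hodge Theory and Complex Algebraic Geometry II (CUP 2003), §9.2.4
  Prop. 9.20.
* [VoisinHodgeI2002] C. Voisin, Hodge Theory and Complex Algebraic Geometry I (CUP 2002), Thm. 6.25,
  Rem. 6.27, §7.1.2, Thm. 11.30.
* [KerrPearlstein2011] M. Kerr, G. Pearlstein, An exponential history of functions with logarithmic
  growth, MSRI Publ. 58 (2011), §3.1.
* [GrothendieckTopology1969] A. Grothendieck, Hodge's general conjecture is false for trivial
  reasons, Topology 8 (1969), §1, pp. 299–300.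
-/

noncomputable section

open CategoryTheory
open Literature.AlgebraicTopology.SingularHomology Literature.Geometry.Kaehler

namespace Literature.AlgebraicGeometry.HodgeTheory

section HodgeTheory

variable {n : ℕ} {X : Motives.SchemeOver ℂ}

/-! ### The bilinear reduction to rational supported classes -/

/-- **Bilinear reduction of `Nˡ H²ˡ ∪ Nᵏ H²ᵏ ⊆ S` to rational supported generators.** For `X` smooth
projective over `ℂ` and a subspace `S ⊆ Hᵐ(X(ℂ); ℂ)`: if `a ∪ b ∈ S` for every RATIONAL `a` dying on
`(X ∖ Z)(ℂ)` (`Z` closed of codimension `≥ l`) and every RATIONAL `b` dying on `(X ∖ W)(ℂ)` (`W`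
closed of codimension `≥ k`), then `a ∪ b ∈ S` for all `a ∈ Nˡ H²ˡ`, `b ∈ Nᵏ H²ᵏ`: the coniveau spaces
are sums of such kernels, each the complex span of its rational classes (Grothendieck's `Filt'`
with `ℂ`-coefficients is the complexification of the rational one,
`span_isRationalClass_eq_top_of_isSmoothProjective_holds` and `ker_restrictCompl_le_span`), and `∪` is
bilinear. [cite: GrothendieckTopology1969, pp. 299–300] -/
theorem cupProduct_mem_of_forall_isRationalClass (hX : Motives.IsSmoothProjective n X) {l k m : ℕ}
    (h : 2 * l + 2 * k = m) {S : Submodule ℂ (complexBetti X m)}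
    (hS : ∀ ⦃Z W : Set X.left⦄, IsClosed Z → (∀ z ∈ Z, (l : ℕ∞) ≤ Order.coheight z) →
      IsClosed W → (∀ w ∈ W, (k : ℕ∞) ≤ Order.coheight w) →
      ∀ ⦃a : complexBetti X (2 * l)⦄ ⦃b : complexBetti X (2 * k)⦄, IsRationalClass a →
        complexBetti.restrictCompl X Z (2 * l) a = 0 → IsRationalClass b →
        complexBetti.restrictCompl X W (2 * k) b = 0 → cupProduct h a b ∈ S)
    {a : complexBetti X (2 * l)} {b : complexBetti X (2 * k)} (ha : a ∈ algebraicClasses X l)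
    (hb : b ∈ algebraicClasses X k) : cupProduct h a b ∈ S := by
  have hspan := span_isRationalClass_eq_top_of_isSmoothProjective_holds
  -- (A) for rational `b` dying off a closed `W` of codimension `≥ k`, every algebraic `a` works
  have hA : ∀ ⦃W : Set X.left⦄, IsClosed W → (∀ w ∈ W, (k : ℕ∞) ≤ Order.coheight w) →
      ∀ ⦃b : complexBetti X (2 * k)⦄, IsRationalClass b →
        complexBetti.restrictCompl X W (2 * k) b = 0 →
        algebraicClasses X l ≤ S.comap ((cupProduct h).flip b) := by
    intro W hW hWk b hb hb0
    refine supportedClasses_le fun Z hZ hZl ↦ ?_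
    refine (span_isRationalClass_eq_top_of_isSmoothProjective.ker_restrictCompl_le_span hspan hX Z
      (2 * l)).trans (Submodule.span_le.2 ?_)
    rintro a ⟨ha, ha0⟩
    rw [SetLike.mem_coe, Submodule.mem_comap, LinearMap.flip_apply]
    exact hS hZ hZl hW hWk ha ha0 hb hb0
  -- (B) then every algebraic `b` works
  have hB : algebraicClasses X k ≤ S.comap (cupProduct h a) := by
    refine supportedClasses_le fun W hW hWk ↦ ?_
    refine (span_isRationalClass_eq_top_of_isSmoothProjective.ker_restrictCompl_le_span hspan hX W
      (2 * k)).trans (Submodule.span_le.2 ?_)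
    rintro b ⟨hb', hb0⟩
    have hab := hA hW hWk hb' hb0 ha
    rw [Submodule.mem_comap, LinearMap.flip_apply] at hab
    rw [SetLike.mem_coe, Submodule.mem_comap]
    exact hab
  exact Submodule.mem_comap.mp (hB hb)

/-! ### Rational `(p, p)`-classes in the Lefschetz range are algebraic, unconditionally -/

/-- **The Hodge conjecture in the Lefschetz range of codimensions, unconditionally**: on a smooth
projective complex `n`-fold every rational `(p, p)`-class with `p ≤ 1` or `n ≤ p + 1` is algebraic
(`p = 0`: `N⁰ H⁰ = H⁰`; `p = 1`: Lefschetz `(1,1)`, Voisin I Thm. 11.30; `n < 2p` with `n − p ≤ 1`: hard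
Lefschetz `Lⁿ⁻² : H² ⥲ H²ⁿ⁻²` over `ℚ` of bidegree `(n−2, n−2)`, Thm. 6.25 / Rem. 6.27 / §7.1.2, and
`[H]ⁿ⁻² ∪ [D] = [Hⁿ⁻² · D]`; `p > n`: no non-zero `(p,p)`-classes) — the tree's
`mem_algebraicClasses_of_lefschetzRange` with its two named-fact inputs replaced by their discharges
`lefschetzOneOne_rational_holds` and `nonempty_hardLefschetzNFold_holds`. In particular the Hodge
conjecture holds for curve classes (`p + 1 = n`). [cite: VoisinHodgeI2002, Thm. 6.25, Rem. 6.27, §7.1.2 and Thm. 11.30]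
[cite: KerrPearlstein2011, §3.1] -/
theorem mem_algebraicClasses_of_lefschetzRange_holds (hX : Motives.IsSmoothProjective n X) {p : ℕ}
    (hp : p ≤ 1 ∨ n ≤ p + 1) (c : complexBetti X (2 * p)) (hc : IsRationalClass c)
    (hpp : IsOfHodgeType n X (2 * p) p p c) : c ∈ algebraicClasses X p :=
  mem_algebraicClasses_of_lefschetzRange lefschetzOneOne_rational_holds
    (nonempty_hardLefschetzNFold_holds n X) hX hp c hc hpp

/-! ### The submaximal degree of Prop. 9.20 -/

/-- **`Nˡ H²ˡ ∪ Nᵏ H²ᵏ ⊆ Nˡ⁺ᵏ H²ˡ⁺²ᵏ` on every smooth projective complex `X` of dimension `≤ l + k + 1`**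
(Voisin II Prop. 9.20 on the coniveau carrier in the top two degrees, with no moving lemma). For
`dim X ≤ l + k` this is the tree's `cupProduct_mem_algebraicClasses_of_dim_le_add` (the top class or
zero); uniformly for `dim X ≤ l + k + 1`: the product of rational supported generators is a rational
`(l + k, l + k)`-class in the Lefschetz range, algebraic by `mem_algebraicClasses_of_lefschetzRange_holds`,
and bilinearity concludes (`cupProduct_mem_of_forall_isRationalClass`).
[cite: VoisinHodgeII2003, §9.2.4 Prop. 9.20] [cite: VoisinHodgeI2002, Thm. 6.25 and Thm. 11.30] -/
theorem cupProduct_mem_algebraicClasses_of_dim_le_add_add_one (hX : Motives.IsSmoothProjective n X)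
    {l k : ℕ} (hn : n ≤ l + k + 1) {a : complexBetti X (2 * l)} {b : complexBetti X (2 * k)}
    (ha : a ∈ algebraicClasses X l) (hb : b ∈ algebraicClasses X k) :
    cupProduct (two_mul_add_two_mul l k) a b ∈ algebraicClasses X (l + k) := by
  refine cupProduct_mem_of_forall_isRationalClass hX _ ?_ ha hb
  intro Z W hZ hZl hW hWk a b ha' ha0 hb' hb0
  -- rational generators give rational `(l + k, l + k)`-classes, algebraic in the Lefschetz range
  have haT : IsOfHodgeType n X (2 * l) l l a :=
    isOfHodgeType_of_mem_algebraicClasses_of_isSmoothProjective hX l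
      (mem_supportedClasses_of_restrictCompl_eq_zero hZ hZl ha0)
  have hbT : IsOfHodgeType n X (2 * k) k k b :=
    isOfHodgeType_of_mem_algebraicClasses_of_isSmoothProjective hX k
      (mem_supportedClasses_of_restrictCompl_eq_zero hW hWk hb0)
  have habT : IsOfHodgeType n X (2 * (l + k)) (l + k) (l + k)
      (cupProduct (two_mul_add_two_mul l k) a b) :=
    cupPreservesHodgeType_of_multiplicative_deRham
      (fun E _ _ _ ↦ Literature.NumberTheory.Transcendental.exists_deRhamIsoFamily_holds E) hX _
      haT hbT
  exact mem_algebraicClasses_of_lefschetzRange_holds hX (Or.inr hn) _ (ha'.cup _ hb') habT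

end HodgeTheory

end Literature.AlgebraicGeometry.HodgeTheory

end
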